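import Summits.HubbardSuperconductivity.HubbardSuperconductivity.Theorems.ThermalWedgeTwSeededEnsembleEquivalenceRConcReduction
import Literature.MathematicalPhysics.QuantumLattice.DWaveSourceLeeYang
import Literature.MathematicalPhysics.QuantumLattice.TransverseWardIdentity

/-!
# Reduction theorems: `TwSeededEnsembleEquivalenceR` from the SIGN of one Duhamel two-point function
# (crux stmt-HubbardSuperconductivity-15581, line `Sketch`, lead c11 — the WARD NORMAL FORM, card ward-anomalous-sign)

Support file (`--supports stmt-HubbardSuperconductivity-15581`; sorry-free; no definition; route-file free apart from
the crux decl via `…RConcReduction`).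

After lead c10 (skeleton v8.5: every finite-dimensional stub landed) and pool seat 0 (`twR_of_condensation_of_fvDeepConcavity`,
`twR_of_fvConcavity`, p145797) the crux `TwSeededEnsembleEquivalenceR` is ONE statement about the d-wave-sourced torus at
the cold slice `β = e^{a/U}`: eventual finite-volume CONCAVITY of `s ↦ p̃_L(β; U, μ, √s)` on the (deep) squared source range.
The transverse Ward identity of `Literature/…/TransverseWardIdentity.lean` (`χ⊥(h) = m(h)/h`: gauge covariance of
`Z_L` in the complex pair source, `e^{cN̂}`) turns that curvature statement into the sign of a two-point function:
`d²/ds² p̃_L(√s) ∝ χ∥ − χ⊥ = (4β/L²)·Re[(Δ_d,Δ_d)_Duh − ⟨Δ_d⟩²]`. This file lands the corresponding reductions: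

* `wr_concaveOn_sourcedPressure_of_longitudinal_le_transverse` — torus dictionary: `χ∥ ≤ χ⊥` along `h ∈ (a,b)`
  ⟹ concavity of the finite-volume sourced pressure in `s` on `[a², b²]`;
* `wr_concaveOn_sourcedPressure_of_anomalous_nonpos` — the same from the anomalous sign
  `Re(Δ_d,Δ_d)_{Duh,h} ≤ (Re⟨Δ_d⟩_h)²`;
* `twR_of_condensation_of_fvDeepHiggsGoldstone` : `TwSourcedCondensation` → DEEP-HG → R, DEEP-HG = "eventually in `L`,
  at `β = e^{a/U}`, for every deep source `h ∈ (e^{−a/(4U)}, 13g+1)`: `Re(Φ₁,Φ₁)_h − (Re⟨Φ₁⟩_h)² ≤ Re(Φ₂,Φ₂)_h`"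
  (longitudinal = amplitude/Higgs pair susceptibility below the transverse = phase/Goldstone one);
* `twR_of_condensation_of_fvDeepAnomalousSign` : `TwSourcedCondensation` → DEEP-SIGN → R, DEEP-SIGN = the same range with
  `Re(Δ_d,Δ_d)_{Duh,h} ≤ (Re⟨Δ_d⟩_h)²` — **the registered physics stub of skeleton v10**;
* `twR_of_condensation_of_deepAnomalousSign` — the planner-facing corollary without the idle binders `K', g`
  (sign on `h ∈ (e^{−a/(4U)}, 3)`), the ONE item recommended for promotion (PROMOTE.md v3);
* `twR_of_fvHiggsGoldstone`, `twR_of_fvAnomalousSign` — the hC-FREE versions on the whole source box `h ∈ (0, 13g+1)`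
  (via `twR_of_fvConcavity`; no use of `TwSourcedCondensation`).

Free values (`U = 0`, BdG): `χ∥ − χ⊥ = −(16h²/L²)Σ_k φ_k⁴|T′(E_k)|/E_k < 0` mode by mode (`T(E) = tanh(βE/2)/E` decreasing),
so every sign hypothesis here holds at `U = 0` for every `β`, `L`, `μ`, `h > 0`; the first-order correction is
`−(U/2)(∂_h n₀)² − (Un₀/2)∂_μ(χ∥−χ⊥)₀` (a negative term plus the Hartree shift of `μ`). What is NOT in print is the
all-order control at `β = e^{a/U}` (constructive-RG class, `U log(1/h) ≤ a/4` on the deep range).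
-/

set_option linter.dupNamespace false

namespace Summit.HubbardSuperconductivity.HubbardSuperconductivity.Theorems

open Matrix Finset Literature.MathematicalPhysics.QuantumLattice
open Summit.HubbardSuperconductivity.HubbardSuperconductivity.Theses.ThermalWedge
open scoped ComplexOrder

/-- **Torus dictionary: `χ∥ ≤ χ⊥` ⟹ `s`-concavity of the sourced pressure.** For the `d`-wave-sourced
Hubbard torus `dWaveSourceTorus L U μ h = H_L(U,μ) − h(Δ_d + Δ_dᴴ)`, `β > 0`, `0 ≤ a, b`: if for every source
`h ∈ (a,b)` the longitudinal Duhamel pair susceptibility is at most the transverse one,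
`Re(Φ₁,Φ₁)_h − (Re⟨Φ₁⟩_h)² ≤ Re(Φ₂,Φ₂)_h` (`Φ₁ = Δ_d + Δ_dᴴ`, `Φ₂ = i(Δ_dᴴ − Δ_d)`), then the finite-volume
sourced pressure `s ↦ log Z_L(β; dWaveSourceTorus L U μ √s)/(βL²)` is concave on `[a², b²]`
(`concaveOn_sq_source_of_longitudinal_le_transverse` with the particle-number grading, charge `q = 2`).
[folklore composition] -/
theorem wr_concaveOn_sourcedPressure_of_longitudinal_le_transverse (L : ℕ) [NeZero L] (U μ : ℝ) {β : ℝ}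
    (hβ : 0 < β) {a b : ℝ} (ha : 0 ≤ a) (hb : 0 ≤ b)
    (hsign : ∀ h ∈ Set.Ioo a b,
      (duhamel β (dWaveSourceTorus L U μ h) (pairField dWaveFormFactor L + (pairField dWaveFormFactor L)ᴴ)
            (pairField dWaveFormFactor L + (pairField dWaveFormFactor L)ᴴ)).re -
          (gibbsState β (dWaveSourceTorus L U μ h)
            (pairField dWaveFormFactor L + (pairField dWaveFormFactor L)ᴴ)).re ^ 2 ≤
        (duhamel β (dWaveSourceTorus L U μ h)
            (Complex.I • ((pairField dWaveFormFactor L)ᴴ - pairField dWaveFormFactor L))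
            (Complex.I • ((pairField dWaveFormFactor L)ᴴ - pairField dWaveFormFactor L))).re) :
    ConcaveOn ℝ (Set.Icc (a ^ 2) (b ^ 2)) (fun s : ℝ =>
      Real.log (partitionFn β (dWaveSourceTorus L U μ (Real.sqrt s))).re / (β * (L : ℝ) ^ 2)) := by
  have hconc := concaveOn_sq_source_of_longitudinal_le_transverse (H := hubbardTorusWith 2 L 1 U μ)
    (Qm := pairField dWaveFormFactor L) (d := fun s => (s.card : ℂ)) (q := (2 : ℂ))
    (isHermitian_hubbardTorusWith L 1 U μ) (diagonal_card_commutator_hubbardTorusWith L U μ)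
    (diagonal_card_commutator_pairField L) (diagonal_card_commutator_pairField_conjTranspose L) two_ne_zero hβ
    ha hb hsign
  have hc : 0 ≤ (β * (L : ℝ) ^ 2)⁻¹ := by positivity
  have h2 := hconc.smul hc
  refine h2.congr ?_   -- same function
  intro s _
  simp only [smul_eq_mul]
  rw [div_eq_inv_mul]
  rfl

/-- **`TwSourcedCondensation` + DEEP `χ∥ ≤ χ⊥` ⟹ R** (line `Sketch`, skeleton v10). If on every window
`[μ₁,μ₂] ⊂ (−4,0)` there is `a₁ > 0` such that for all `a ∈ (0,a₁]` there are `K', U₀ > 0` with: for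
`U ∈ (0,U₀]`, `g ∈ [K'U, 1/10]`, interior `μ`, eventually in `L`, at `β = e^{a/U}` and every DEEP source
`h ∈ (e^{−a/(4U)}, 13g+1)` the longitudinal Duhamel `d`-wave pair susceptibility of the sourced torus is at most the
transverse one — equivalently (transverse Ward identity) at most the chord susceptibility `Re⟨Φ₁⟩_h/(βh)`, equivalently
the truncated anomalous pair correlator has the free (BCS) sign — then `TwSeededEnsembleEquivalenceR`
(`wr_concaveOn_sourcedPressure_of_longitudinal_le_transverse` ∘ `twR_of_condensation_of_fvDeepConcavity`).
[folklore composition] -/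
theorem twR_of_condensation_of_fvDeepHiggsGoldstone :
    TwSourcedCondensation →
    (∀ (μ₁ μ₂ : ℝ), -4 < μ₁ → μ₁ < μ₂ → μ₂ < 0 → ∃ a₁ : ℝ, 0 < a₁ ∧ ∀ a ∈ Set.Ioc (0 : ℝ) a₁,
      ∃ K' U₀ : ℝ, 0 < K' ∧ 0 < U₀ ∧ ∀ U ∈ Set.Ioc (0 : ℝ) U₀, ∀ g ∈ Set.Icc (K' * U) (1 / 10),
        ∀ μ ∈ Set.Ioo μ₁ μ₂, ∃ L₀ : ℕ, ∀ (L : ℕ) [NeZero L], L₀ ≤ L →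
          ∀ h ∈ Set.Ioo (Real.exp (-(a / (4 * U)))) (13 * g + 1),
            (duhamel (Real.exp (a / U)) (dWaveSourceTorus L U μ h)
                  (pairField dWaveFormFactor L + (pairField dWaveFormFactor L)ᴴ)
                  (pairField dWaveFormFactor L + (pairField dWaveFormFactor L)ᴴ)).re -
                (gibbsState (Real.exp (a / U)) (dWaveSourceTorus L U μ h)
                  (pairField dWaveFormFactor L + (pairField dWaveFormFactor L)ᴴ)).re ^ 2 ≤
              (duhamel (Real.exp (a / U)) (dWaveSourceTorus L U μ h)
                  (Complex.I • ((pairField dWaveFormFactor L)ᴴ - pairField dWaveFormFactor L))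
                  (Complex.I • ((pairField dWaveFormFactor L)ᴴ - pairField dWaveFormFactor L))).re) →
    TwSeededEnsembleEquivalenceR := by
  intro hC hHG
  refine twR_of_condensation_of_fvDeepConcavity hC ?_
  intro μ₁ μ₂ h4 h12 h0
  obtain ⟨a₁, ha₁, hA⟩ := hHG μ₁ μ₂ h4 h12 h0
  refine ⟨a₁, ha₁, fun a ha => ?_⟩
  obtain ⟨K', U₀, hK', hU₀, hB⟩ := hA a ha
  refine ⟨K', U₀, hK', hU₀, fun U hU g hg μ hμ => ?_⟩
  obtain ⟨L₀, hL₀⟩ := hB U hU g hg μ hμ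
  refine ⟨L₀, fun L _ hL => ?_⟩
  have hg0 : 0 < g := lt_of_lt_of_le (mul_pos hK' hU.1) hg.1
  have hb : 0 ≤ 13 * g + 1 := by positivity
  have hsq : Real.exp (-(a / (4 * U))) ^ 2 = Real.exp (-(a / (2 * U))) := by
    rw [sq, ← Real.exp_add]
    congr 1
    ring
  have h := wr_concaveOn_sourcedPressure_of_longitudinal_le_transverse L U μ (Real.exp_pos (a / U))
    (Real.exp_pos _).le hb (hL₀ L hL)
  rwa [hsq] at h

/-- **`χ∥ ≤ χ⊥` on the whole source box ⟹ R, with NO use of `TwSourcedCondensation`.** If on every window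
there are `a, K', U₀ > 0` with: for `U ∈ (0,U₀]`, `g ∈ [K'U,1/10]`, interior `μ`, eventually in `L`, at `β = e^{a/U}`
and every source `h ∈ (0, 13g+1)` the longitudinal Duhamel `d`-wave pair susceptibility of the sourced torus is at
most the transverse one, then `TwSeededEnsembleEquivalenceR`
(`wr_concaveOn_sourcedPressure_of_longitudinal_le_transverse` with `a = 0` ∘ `twR_of_fvConcavity`).
[folklore composition] -/
theorem twR_of_fvHiggsGoldstone :
    (∀ (μ₁ μ₂ : ℝ), -4 < μ₁ → μ₁ < μ₂ → μ₂ < 0 → ∃ a K' U₀ : ℝ, 0 < a ∧ 0 < K' ∧ 0 < U₀ ∧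
      ∀ U ∈ Set.Ioc (0 : ℝ) U₀, ∀ g ∈ Set.Icc (K' * U) (1 / 10), ∀ μ ∈ Set.Ioo μ₁ μ₂,
        ∃ L₀ : ℕ, ∀ (L : ℕ) [NeZero L], L₀ ≤ L →
          ∀ h ∈ Set.Ioo (0 : ℝ) (13 * g + 1),
            (duhamel (Real.exp (a / U)) (dWaveSourceTorus L U μ h)
                  (pairField dWaveFormFactor L + (pairField dWaveFormFactor L)ᴴ)
                  (pairField dWaveFormFactor L + (pairField dWaveFormFactor L)ᴴ)).re -
                (gibbsState (Real.exp (a / U)) (dWaveSourceTorus L U μ h)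
                  (pairField dWaveFormFactor L + (pairField dWaveFormFactor L)ᴴ)).re ^ 2 ≤
              (duhamel (Real.exp (a / U)) (dWaveSourceTorus L U μ h)
                  (Complex.I • ((pairField dWaveFormFactor L)ᴴ - pairField dWaveFormFactor L))
                  (Complex.I • ((pairField dWaveFormFactor L)ᴴ - pairField dWaveFormFactor L))).re) →
    TwSeededEnsembleEquivalenceR := by
  intro hHG
  refine twR_of_fvConcavity ?_
  intro μ₁ μ₂ h4 h12 h0
  obtain ⟨a, K', U₀, ha, hK', hU₀, hA⟩ := hHG μ₁ μ₂ h4 h12 h0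
  refine ⟨a, K', U₀, ha, hK', hU₀, fun U hU g hg μ hμ => ?_⟩
  obtain ⟨L₀, hL₀⟩ := hA U hU g hg μ hμ
  refine ⟨L₀, fun L _ hL => ?_⟩
  have hg0 : 0 < g := lt_of_lt_of_le (mul_pos hK' hU.1) hg.1
  have hb : 0 ≤ 13 * g + 1 := by positivity
  have h := wr_concaveOn_sourcedPressure_of_longitudinal_le_transverse L U μ (Real.exp_pos (a / U))
    le_rfl hb (hL₀ L hL)
  rwa [sq, mul_zero] at h


/-- **Torus dictionary, anomalous form: `Re(Δ_d,Δ_d)_Duh ≤ (Re⟨Δ_d⟩)²` ⟹ `s`-concavity.** As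
`wr_concaveOn_sourcedPressure_of_longitudinal_le_transverse`, with the hypothesis that the truncated anomalous Duhamel
pair correlator of the sourced torus is non-positive along `h ∈ (a,b)` (`concaveOn_sq_source_of_anomalous_nonpos`).
[folklore composition] -/
theorem wr_concaveOn_sourcedPressure_of_anomalous_nonpos (L : ℕ) [NeZero L] (U μ : ℝ) {β : ℝ}
    (hβ : 0 < β) {a b : ℝ} (ha : 0 ≤ a) (hb : 0 ≤ b)
    (hsign : ∀ h ∈ Set.Ioo a b,
      (duhamel β (dWaveSourceTorus L U μ h) (pairField dWaveFormFactor L) (pairField dWaveFormFactor L)).re ≤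
        (gibbsState β (dWaveSourceTorus L U μ h) (pairField dWaveFormFactor L)).re ^ 2) :
    ConcaveOn ℝ (Set.Icc (a ^ 2) (b ^ 2)) (fun s : ℝ =>
      Real.log (partitionFn β (dWaveSourceTorus L U μ (Real.sqrt s))).re / (β * (L : ℝ) ^ 2)) := by
  have hconc := concaveOn_sq_source_of_anomalous_nonpos (H := hubbardTorusWith 2 L 1 U μ)
    (Qm := pairField dWaveFormFactor L) (d := fun s => (s.card : ℂ)) (q := (2 : ℂ))
    (isHermitian_hubbardTorusWith L 1 U μ) (diagonal_card_commutator_hubbardTorusWith L U μ)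
    (diagonal_card_commutator_pairField L) (diagonal_card_commutator_pairField_conjTranspose L) two_ne_zero hβ
    ha hb hsign
  have hc : 0 ≤ (β * (L : ℝ) ^ 2)⁻¹ := by positivity
  have h2 := hconc.smul hc
  refine h2.congr ?_
  intro s _
  simp only [smul_eq_mul]
  rw [div_eq_inv_mul]
  rfl

/-- **`TwSourcedCondensation` + DEEP ANOMALOUS SIGN ⟹ R** (line `Sketch`, skeleton v10: THE registered physics stub
in its Ward normal form). If on every window `[μ₁,μ₂] ⊂ (−4,0)` there is `a₁ > 0` such that for all `a ∈ (0,a₁]` there are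
`K', U₀ > 0` with: for `U ∈ (0,U₀]`, `g ∈ [K'U, 1/10]`, interior `μ`, eventually in `L`, at `β = e^{a/U}` and every DEEP
source `h ∈ (e^{−a/(4U)}, 13g+1)`, the truncated ANOMALOUS Duhamel `d`-wave pair correlator of the sourced torus is
non-positive, `Re(Δ_d,Δ_d)_{Duh,h} ≤ (Re⟨Δ_d⟩_h)²` (its free BdG value `−(4h²/L²)Σ_kφ_k⁴|T′(E_k)|/E_k·(L²/β)/4 …` has this
sign mode by mode), then `TwSeededEnsembleEquivalenceR`. [folklore composition] -/
theorem twR_of_condensation_of_fvDeepAnomalousSign :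
    TwSourcedCondensation →
    (∀ (μ₁ μ₂ : ℝ), -4 < μ₁ → μ₁ < μ₂ → μ₂ < 0 → ∃ a₁ : ℝ, 0 < a₁ ∧ ∀ a ∈ Set.Ioc (0 : ℝ) a₁,
      ∃ K' U₀ : ℝ, 0 < K' ∧ 0 < U₀ ∧ ∀ U ∈ Set.Ioc (0 : ℝ) U₀, ∀ g ∈ Set.Icc (K' * U) (1 / 10),
        ∀ μ ∈ Set.Ioo μ₁ μ₂, ∃ L₀ : ℕ, ∀ (L : ℕ) [NeZero L], L₀ ≤ L →
          ∀ h ∈ Set.Ioo (Real.exp (-(a / (4 * U)))) (13 * g + 1),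
            (duhamel (Real.exp (a / U)) (dWaveSourceTorus L U μ h)
                (pairField dWaveFormFactor L) (pairField dWaveFormFactor L)).re ≤
              (gibbsState (Real.exp (a / U)) (dWaveSourceTorus L U μ h) (pairField dWaveFormFactor L)).re ^ 2) →
    TwSeededEnsembleEquivalenceR := by
  intro hC hS
  refine twR_of_condensation_of_fvDeepConcavity hC ?_
  intro μ₁ μ₂ h4 h12 h0
  obtain ⟨a₁, ha₁, hA⟩ := hS μ₁ μ₂ h4 h12 h0
  refine ⟨a₁, ha₁, fun a ha => ?_⟩
  obtain ⟨K', U₀, hK', hU₀, hB⟩ := hA a ha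
  refine ⟨K', U₀, hK', hU₀, fun U hU g hg μ hμ => ?_⟩
  obtain ⟨L₀, hL₀⟩ := hB U hU g hg μ hμ
  refine ⟨L₀, fun L _ hL => ?_⟩
  have hg0 : 0 < g := lt_of_lt_of_le (mul_pos hK' hU.1) hg.1
  have hb : 0 ≤ 13 * g + 1 := by positivity
  have hsq : Real.exp (-(a / (4 * U))) ^ 2 = Real.exp (-(a / (2 * U))) := by
    rw [sq, ← Real.exp_add]
    congr 1
    ring
  have h := wr_concaveOn_sourcedPressure_of_anomalous_nonpos L U μ (Real.exp_pos (a / U))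
    (Real.exp_pos _).le hb (hL₀ L hL)
  rwa [hsq] at h

/-- **ANOMALOUS SIGN on the whole source box ⟹ R, with NO use of `TwSourcedCondensation`.** [folklore composition] -/
theorem twR_of_fvAnomalousSign :
    (∀ (μ₁ μ₂ : ℝ), -4 < μ₁ → μ₁ < μ₂ → μ₂ < 0 → ∃ a K' U₀ : ℝ, 0 < a ∧ 0 < K' ∧ 0 < U₀ ∧
      ∀ U ∈ Set.Ioc (0 : ℝ) U₀, ∀ g ∈ Set.Icc (K' * U) (1 / 10), ∀ μ ∈ Set.Ioo μ₁ μ₂,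
        ∃ L₀ : ℕ, ∀ (L : ℕ) [NeZero L], L₀ ≤ L →
          ∀ h ∈ Set.Ioo (0 : ℝ) (13 * g + 1),
            (duhamel (Real.exp (a / U)) (dWaveSourceTorus L U μ h)
                (pairField dWaveFormFactor L) (pairField dWaveFormFactor L)).re ≤
              (gibbsState (Real.exp (a / U)) (dWaveSourceTorus L U μ h) (pairField dWaveFormFactor L)).re ^ 2) →
    TwSeededEnsembleEquivalenceR := by
  intro hS
  refine twR_of_fvConcavity ?_
  intro μ₁ μ₂ h4 h12 h0
  obtain ⟨a, K', U₀, ha, hK', hU₀, hA⟩ := hS μ₁ μ₂ h4 h12 h0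
  refine ⟨a, K', U₀, ha, hK', hU₀, fun U hU g hg μ hμ => ?_⟩
  obtain ⟨L₀, hL₀⟩ := hA U hU g hg μ hμ
  refine ⟨L₀, fun L _ hL => ?_⟩
  have hg0 : 0 < g := lt_of_lt_of_le (mul_pos hK' hU.1) hg.1
  have hb : 0 ≤ 13 * g + 1 := by positivity
  have h := wr_concaveOn_sourcedPressure_of_anomalous_nonpos L U μ (Real.exp_pos (a / U)) le_rfl hb (hL₀ L hL)
  rwa [sq, mul_zero] at h

/-- **The planner-facing form (no idle binders): `TwSourcedCondensation` + DEEP ANOMALOUS SIGN on `(e^{−a/(4U)}, 3)` ⟹ R.**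
In `twR_of_condensation_of_fvDeepAnomalousSign` the seed data `K', g` enter the sign hypothesis only through the box end
`13g+1 ≤ 23/10 < 3`; this corollary states the physics input without them: on every window `[μ₁,μ₂] ⊂ (−4,0)` there is
`a₁ > 0` such that for all `a ∈ (0,a₁]` there is `U₀ > 0` with: for `U ∈ (0,U₀]`, interior `μ`, eventually in `L`, at
`β = e^{a/U}` and every source `h ∈ (e^{−a/(4U)}, 3)`, `Re(Δ_d,Δ_d)_{Duh} ≤ (Re⟨Δ_d⟩)²` on the sourced torus. This is the ONE
item recommended for promotion (Cruxes/…/PROMOTE.md v3). [folklore composition] -/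
theorem twR_of_condensation_of_deepAnomalousSign :
    TwSourcedCondensation →
    (∀ (μ₁ μ₂ : ℝ), -4 < μ₁ → μ₁ < μ₂ → μ₂ < 0 → ∃ a₁ : ℝ, 0 < a₁ ∧ ∀ a ∈ Set.Ioc (0 : ℝ) a₁,
      ∃ U₀ : ℝ, 0 < U₀ ∧ ∀ U ∈ Set.Ioc (0 : ℝ) U₀,
        ∀ μ ∈ Set.Ioo μ₁ μ₂, ∃ L₀ : ℕ, ∀ (L : ℕ) [NeZero L], L₀ ≤ L →
          ∀ h ∈ Set.Ioo (Real.exp (-(a / (4 * U)))) 3,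
            (duhamel (Real.exp (a / U)) (dWaveSourceTorus L U μ h)
                (pairField dWaveFormFactor L) (pairField dWaveFormFactor L)).re ≤
              (gibbsState (Real.exp (a / U)) (dWaveSourceTorus L U μ h) (pairField dWaveFormFactor L)).re ^ 2) →
    TwSeededEnsembleEquivalenceR := by
  intro hC hS
  refine twR_of_condensation_of_fvDeepAnomalousSign hC ?_
  intro μ₁ μ₂ h4 h12 h0
  obtain ⟨a₁, ha₁, hA⟩ := hS μ₁ μ₂ h4 h12 h0
  refine ⟨a₁, ha₁, fun a ha => ?_⟩
  obtain ⟨U₀, hU₀, hB⟩ := hA a ha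
  refine ⟨1, U₀, one_pos, hU₀, fun U hU g hg μ hμ => ?_⟩
  obtain ⟨L₀, hL₀⟩ := hB U hU μ hμ
  refine ⟨L₀, fun L _ hL h hh => hL₀ L hL h ⟨hh.1, ?_⟩⟩
  have hg' : 13 * g + 1 < 3 := by linarith [hg.2]
  exact lt_trans hh.2 hg'

end Summit.HubbardSuperconductivity.HubbardSuperconductivity.Theorems
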